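import Literature.Topology.FourManifolds.HomotopySpheresStablyParallelizableSpinSixCover
import HarnessLib

/-!
# Bott's `π₆(SO(8)) = 0` ⇐ `π₆(SU(N)) = 0` for one `N ≥ 4` (Bott) and unitary stability down to `SU(4)` (fact split)

Topic `Literature/Topology/FourManifolds`. Fact-decomposition file (librarian, mode
`fact-decompose`, 2026-08-16) for the named fact
`Literature.Topology.FourManifolds.Bott1959_sphereMapsToStableFramesExtend_six`
(`HomotopySpheresStablyParallelizable.lean`: every continuous map from `𝕊⁶` to the stable frames of
`ℝ⁷` extends over `ℝ⁷` — the extension form of `π₆(SO(8)) = 0`, R. Bott, Ann. of Math. 70 (1959),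
the input of Kervaire–Milnor's Thm. 3.1 at `n = 7`).

The tree has PROVED the whole orthogonal side of the reduction:
`Bott1959_… ↔ Subsingleton (π_ 6 SO(8) 1)` (`…Orthogonal.lean`), `π₆(SO(7)) = 0 ⇒ π₆(SO(8)) = 0`
(`…Seven.lean`), `π₆(SO(6)) = 0 ⇒ π₆(SO(7)) = 0` (`…Even.lean`, Steenrod §23.4), and the transfer
along the two-sheeted covering `SU(4) → SO(6)` (`Spin(6) ≅ SU(4)`, `…SpinSix.lean`,
`…SpinSixCover.lean`): `Bott1959_sphereMapsToStableFramesExtend_six_of_specialUnitaryGroup_four :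
Subsingleton (π_ 6 SU(4) 1) → Bott1959_…`.  What remains is the UNITARY value `π₆(SU(4)) = 0`,
which in print is "`π₆(SU(4)) = π₆(SU) = π₆(U) = 0`": complex Bott periodicity in the stable range.
This file NAMES the two halves of that sentence and records the PROVED assembly:

* `Bott1959_exists_subsingleton_pi_six_specialUnitaryGroup` — **Bott periodicity, stable value**:
  `π₆(SU(N), 1) = 0` for SOME `N ≥ 4` (Bott 1959, §1 (1.5): `π_k(U) = 0` for `k` even; with
  `π₆(U(N)) ≅ π₆(U)` for `N ≥ 4` and `π₆(SU(N)) ≅ π₆(U(N))`).  Existential in `N` so that ANY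
  stable-range computation discharges it.
* `subsingleton_pi_six_specialUnitaryGroup_stability` — **unitary stability down to `SU(4)`**:
  for `N ≥ 4`, `π₆(SU(N+1), 1) = 0 ⇒ π₆(SU(N), 1) = 0` (the bundle `SU(N) → SU(N+1) → S^{2N+1}`
  and `π₇(S^{2N+1}) = π₆(S^{2N+1}) = 0` for `N ≥ 4`; Steenrod 1951 §§24–25, Hatcher §4.2 — the
  unitary twin of the tree's `subsingleton_homotopyGroup_specialOrthogonalGroup_succ_of` /
  `…GeneralLinear.lean` descent for the orthogonal and general linear groups).
* `Bott1959_sphereMapsToStableFramesExtend_six_holds_of` — PROVED: descend from `N` to `4` by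
  induction and apply `…_of_specialUnitaryGroup_four`.

Neither child restates the parent (statements about `SU(N)`, not about stable frames of `ℝ⁷` or
`SO(8)`); the second is provable with the tree's sphere and covering-space machinery, the first
isolates Bott's theorem proper in its printed, stable form.

## References

* R. Bott, *The stable homotopy of the classical groups*, Ann. of Math. (2) 70 (1959) 313–337, §1,
  Cor. to Thm. II, (1.5), p. 315 (`π_k(U)`: `0, ℤ` for `k` even, odd). [Bott1959]
* N. Steenrod, *The Topology of Fibre Bundles*, PUP 1951, §§24–25 (homotopy groups of the unitary
  groups, the bundles `U(n) → S^{2n-1}`, stable range). [Steenrod1951]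
* A. Hatcher, *Algebraic Topology*, CUP 2002, §4.2 (long exact sequence of a fibre bundle; stability
  of `π_i(U(n))`). [HatcherAT2002]
-/

noncomputable section

open scoped Manifold Topology Topology.Homotopy Matrix

namespace Literature.Topology.FourManifolds

/-- **Bott periodicity, the stable value `π₆ = 0` for the special unitary groups** (R. Bott 1959,
§1, Cor. to Thm. II and (1.5): the stable homotopy of the unitary group is `π_k(U) = 0` for `k`
even, `ℤ` for `k` odd; `π₆(U(N)) ≅ π₆(U)` in the stable range `N ≥ 4`, and
`π₆(SU(N)) ≅ π₆(U(N))` from `U(N) ≃ SU(N) × S¹`): there is SOME `N ≥ 4` with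
`π₆(SU(N), 1) = 0`, `SU(N)` being Mathlib's `Matrix.specialUnitaryGroup (Fin N) ℂ` with the
subspace topology (a compact topological group, `GaugeGroups.lean`) and `π_ 6` Mathlib's
`HomotopyGroup.Pi 6` at the identity.  Existential in `N`: any stable-range instance (`N = 4`
directly, or a large `N` combined with `subsingleton_pi_six_specialUnitaryGroup_stability`)
discharges it; the tree needs `N = 4` (`…SpinSixCover.lean`).
[cite: Bott1959, §1, Corollary to Theorem II and (1.5), p. 315] -/
def Bott1959_exists_subsingleton_pi_six_specialUnitaryGroup : Prop :=
  ∃ N : ℕ, 4 ≤ N ∧ Subsingleton (π_ 6 (Matrix.specialUnitaryGroup (Fin N) ℂ) 1)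

/-- **Stability of `π₆` of the special unitary groups down to `SU(4)`**: for `N ≥ 4`, if
`π₆(SU(N+1), 1) = 0` then `π₆(SU(N), 1) = 0`.  Printed mechanism: the principal bundle
`SU(N) → SU(N+1) → S^{2N+1}` (first column) gives the exact sequence
`π₇(S^{2N+1}) → π₆(SU(N)) → π₆(SU(N+1))`, and `π₇(S^{2N+1}) = 0` for `2N + 1 ≥ 9`, so
`π₆(SU(N)) → π₆(SU(N+1))` is injective for `N ≥ 4` (Steenrod 1951, §§24–25; Hatcher, §4.2:
`π_i(U(n))` is independent of `n` for `n > i/2`).  In the tree's idiom (no long exact sequence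
needed): a map `𝕊⁶ → SU(N+1)` is homotopic, by general position off the last column's sphere
`S^{2N+1}` of dimension `> 7`, to one into the stabiliser `SU(N)`, uniformly in a homotopy — the
unitary twin of `subsingleton_homotopyGroup_specialOrthogonalGroup_succ_of` (`…Stability.lean`)
and of the general-linear descent of `…GeneralLinear.lean`. [cite: Steenrod1951, §§24–25]
[cite: HatcherAT2002, §4.2] -/
def subsingleton_pi_six_specialUnitaryGroup_stability : Prop :=
  ∀ N : ℕ, 4 ≤ N → Subsingleton (π_ 6 (Matrix.specialUnitaryGroup (Fin (N + 1)) ℂ) 1) →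
    Subsingleton (π_ 6 (Matrix.specialUnitaryGroup (Fin N) ℂ) 1)

/-- **Assembly (fact split): Bott's `π₆(SO(8)) = 0` in extension form from the stable unitary
value and unitary stability.**  From `π₆(SU(N)) = 0` for some `N ≥ 4` descend to `π₆(SU(4)) = 0`
by `subsingleton_pi_six_specialUnitaryGroup_stability`, then apply the tree's
`Bott1959_sphereMapsToStableFramesExtend_six_of_specialUnitaryGroup_four`
(`SU(4) → SO(6)` covering, `SO(6) → SO(7) → SO(8)`, and the frame/`SO(8)` dictionary, all
proved). [cite: Bott1959, §1, (1.5), p. 315] -/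
theorem Bott1959_sphereMapsToStableFramesExtend_six_holds_of
    (h1 : Bott1959_exists_subsingleton_pi_six_specialUnitaryGroup)
    (h2 : subsingleton_pi_six_specialUnitaryGroup_stability) :
    Bott1959_sphereMapsToStableFramesExtend_six := by
  obtain ⟨N, hN, hsub⟩ := h1
  have key : ∀ n : ℕ, 4 ≤ n → Subsingleton (π_ 6 (Matrix.specialUnitaryGroup (Fin n) ℂ) 1) →
      Subsingleton (π_ 6 (Matrix.specialUnitaryGroup (Fin 4) ℂ) 1) := by
    intro n hn
    induction n, hn using Nat.le_induction with
    | base => exact id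
    | succ n hn ih => exact fun h => ih (h2 n hn h)
  exact Bott1959_sphereMapsToStableFramesExtend_six_of_specialUnitaryGroup_four (key N hN hsub)

end Literature.Topology.FourManifolds

end
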